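import Literature.NumberTheory.Automorphic.CDTTheorem722
import Literature.NumberTheory.Automorphic.CDTTheorem712TwoLiftsProofs
import Literature.NumberTheory.Automorphic.FLSModularityLiftingTheorem
import Literature.NumberTheory.Automorphic.FLSResidualImageCriteria
import Literature.NumberTheory.Automorphic.GL2AdelicWeightVectors
import Literature.NumberTheory.Automorphic.AutomorphicRepsGL2WeightOneHeckeEigenform
import Literature.NumberTheory.Automorphic.GL2NewvectorExistence
import Literature.NumberTheory.EllipticCurves.NewformsMainLemmaProofs
import Literature.NumberTheory.EllipticCurves.NewformsLiftProofs
import Literature.NumberTheory.Automorphic.CDTTheorem722SerreProofs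
import Literature.NumberTheory.EllipticCurves.IsogenyFrobeniusTraceHoldsProofs
import Literature.NumberTheory.EllipticCurves.GlobalMinimalModelProofs
import Literature.NumberTheory.EllipticCurves.LFunctionSmulProofs
import Literature.NumberTheory.EllipticCurves.SzpiroOfAbcProofs
import Literature.NumberTheory.EllipticCurves.MatarNekovar2019.IrreducibleOverQuadraticFieldClauseThreeProofs
import Literature.RepresentationTheory.Semisimple.BurnsideMatrixSpan
import Literature.NumberTheory.GaloisRepresentations.AbsolutelyIrreducibleReductionBridge
import Summits.ABC.ABC.Theorems.DefiniteXiFreyModularityStubAbsIrrNegThreeGroup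
import HarnessLib

/-!
# Stub-ideation k1, GEN 5 (2026-08-31) for `stub_liftThree` (crux stmt-ABC-11340 `FreyModularity`, line `Sketch`)

Backs `STUB-IDEAS-stub_liftThree-1.md`, HOME FAMILY 1 (RECOGNISE & IMPORT).  Gen 5 = **wire the
seats, vend nothing**: the tree-consumer census says the route's single `ℓ = 3` debt must be the
named fact `BCDT.CDT_theorem_7_2_1` (18 Literature + 6 ABC consumers; the skeleton's own proved
closer `stub_liftThree_of_CDT_theorem_7_2_1`; the sibling crux `EisensteinQuarantine`'s critic
already chose `blocked-on: CDT_theorem_7_2_1`), while the Rubin / Diamond / `LiftThree` Props of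
gens 1–4 have ZERO consumers outside this crux directory.  Contents:

* §0 the stub's registered signature (verbatim) and the two-line closers from the two
  most-consumed carriers: `exists_isNewformOf` (BCDT Thm A, 336 Literature consumers; W0, PROVED)
  and `CDT_theorem_7_2_1` (W0′, PROVED — calibration copy of `Lines/Sketch.lean:567`);
* §1–§2 the FACT-WEB EDGE W1 `FLS2015_theorem3 → B3 → IsModularOfAbsIrrThree → CDT_theorem_7_2_1`
  (gen 4's closer D with its last token removed: `27 ∤ N`, `9 ∤ N`, `ρ̄ modular` all unused),
  PROVED here (gen-4 §§1–3 carried over verbatim so that this file is self-contained; the crux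
  module `STUB_IDEAS_stub_liftThree_1g4` is not importable on the farm);
* §3 the FAMILY-1 TRANSFER weight `1 ↦ 2` of the tree's Gelbart dictionary: the one shared
  L-debt B3/D4a (`exists_isNewform0_of_isAutomorphicOfWeightZero_rat`, sorried in k2's
  `STUB_IDEAS_stub_liftFive_2g3.lean:323` and k1 g3) SPLIT into typed, cycle-sized ports
  H-arch (PROVED here) / H-extract / H-liouville / H-even / H-hecke / H-dict (`sorry`,
  signatures only — this is an ideation file), every other step being a PROVED weight-general tree lemma
  (`CuspidalAutomorphicRepData.exists_gammaOneFiniteLevel_fixed`, `adelicDescentCuspForm N k`,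
  `heckeOperator_principalCongruenceLevel_adelicLiftFunA_one/two` (general `k`!),
  `mem_newSubspace1_of_forall_fixed`, `exists_isNewform1_of_mem_newSubspace1`,
  `exists_liftToGamma1_eq_of_forall_diamondOp_eq`, `isNewform1_liftToGamma1_iff_holds`,
  `hasSatakeParamAt_unique_holds`).

`lean check` rc 0: 6 sorries, ONLY in §3 (H-extract, H-liouville, H-even, H-hecke, H-dict, D4a restatement).
-/

set_option autoImplicit false
set_option linter.dupNamespace false

-- Mathlib idiom (needed to mention `toLie` / Lie derivatives along matrix Lie algebras)
attribute [local instance 100] LieRing.ofAssociativeRing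

noncomputable section

open scoped MatrixGroups NumberField Polynomial ModularForm Classical -- `Classical`: `NormedCommRing (mixedSpace ℚ)` for `AutomorphyDatum.gl`
open Polynomial NumberField IsDedekindDomain
open Literature.NumberTheory.EllipticCurves
open Literature.NumberTheory.EllipticCurves.ModularForms
open Literature.NumberTheory.Automorphic
open Literature.NumberTheory.Automorphic.BCDT
open Literature.NumberTheory.Automorphic.GL2Real
open Literature.NumberTheory.GaloisRepresentations
open Literature.RepresentationTheory.Semisimple
open CongruenceSubgroup Rat.HeightOneSpectrum

universe v

namespace Summit.ABC.ABC.Cruxes.FreyModularity.Sketch.StubIdeas1g5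

attribute [local instance] neZero_natGenerator

/-! ## §0  The stub and its two-line closers from the two most-consumed carriers -/

/-- The registered signature of `stub_liftThree` (verbatim copy; the stub itself is not re-typed). -/
def SigStubLiftThree : Prop :=
  ∀ (W : WeierstrassCurve ℚ) [W.IsElliptic] (ρ : ModPGaloisRep ℚ (ZMod 3) 2),
    W.IsTorsionGaloisRep 3 ρ → ρ.IsAbsIrreducibleOverSqrt (-3) → ¬ 9 ∣ W.conductorNorm ℤ →
    ρ.IsModular → W.IsModularGaloisRepTate 3

/-- **W0 (PROVED).** The umbrella carrier: BCDT Theorem A in the tree's form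
`exists_isNewformOf` (336 Literature consumers) closes the stub via the tree's (1) ⇒ (4)
`isModularGaloisRepTate_of_exists_isNewformOf`; every binder but `W` unused.
[cite: BCDTJAMS2001, Thm. A] -/
theorem stub_liftThree_of_exists_isNewformOf (hA : exists_isNewformOf) : SigStubLiftThree := by
  intro W _ ρ _ _ _ _
  haveI : Fact (Nat.Prime 3) := ⟨Nat.prime_three⟩
  exact isModularGaloisRepTate_of_exists_isNewformOf hA W 3

/-- Calibration: the umbrella carrier trivially implies the seat (`27 ∤ N_E` and `ρ̄` unused).
[cite: ConradDiamondTaylor1999, Thm. 7.2.1] -/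
theorem CDT_theorem_7_2_1_of_exists_isNewformOf (hA : exists_isNewformOf) : CDT_theorem_7_2_1 :=
  fun W _ _ _ _ _ _ ↦ exists_isNewformOf_iff.mp hA W

/-- **W0′ (PROVED; = `Lines/Sketch.lean`'s `stub_liftThree_of_CDT_theorem_7_2_1`).** The SEAT:
`CDT_theorem_7_2_1` closes the stub in one line (`9 ∤ N ⇒ 27 ∤ N`; `ρ̄ modular` unused).
[cite: ConradDiamondTaylor1999, Thm. 7.2.1] -/
theorem stub_liftThree_of_CDT_theorem_7_2_1 (h : CDT_theorem_7_2_1) : SigStubLiftThree :=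
  fun W _ ρ hρ hirr h9 _ ↦
    lift_three_of_CDT_theorem_7_2_1 h W ρ hρ hirr fun h27 ↦ h9 (dvd_trans (by norm_num) h27)

/-! ## §1  (carried over from gen 4, PROVED) image lemmas R1, D1b, R0, D1 and bridges B4, B6 -/

section Image

variable {G : Type*} [Group G] [TopologicalSpace G] {H₁ : Type*} [Group H₁] [TopologicalSpace H₁]
  {H₂ : Type*} [Group H₂] [TopologicalSpace H₂] {A : Type v} [Field A] [TopologicalSpace A] {n : ℕ}

/-- **R1 (PROVED, gen 4).** Absolute irreducibility of a pull-back is monotone in the image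
(Burnside, `span_eq_top_iff_forall_isIrreducible`). [folklore] -/
theorem isAbsolutelyIrreducible_comp_of_range_subset (hn : 0 < n) (ρ : FramedRep G A n)
    (φ₁ : H₁ →ₜ* G) (φ₂ : H₂ →ₜ* G) (hle : Set.range φ₁ ⊆ Set.range φ₂)
    (h : FramedRep.IsAbsolutelyIrreducible (ρ.comp φ₁)) :
    FramedRep.IsAbsolutelyIrreducible (ρ.comp φ₂) := by
  have h1 := (span_eq_top_iff_forall_isIrreducible hn
    ((ρ.comp φ₁ : FramedRep H₁ A n) : H₁ →* GL (Fin n) A)).2 h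
  refine (span_eq_top_iff_forall_isIrreducible hn
    ((ρ.comp φ₂ : FramedRep H₂ A n) : H₂ →* GL (Fin n) A)).1 (eq_top_iff.2 ?_)
  rw [← h1]
  refine Submodule.span_mono ?_
  rintro _ ⟨x, rfl⟩
  obtain ⟨y, hy⟩ := hle ⟨x, rfl⟩
  refine ⟨y, ?_⟩
  change ((ρ (φ₂ y) : GL (Fin n) A) : Matrix (Fin n) (Fin n) A) =
    ((ρ (φ₁ x) : GL (Fin n) A) : Matrix (Fin n) (Fin n) A)
  rw [hy]

/-- **D1b (PROVED, gen 4).** Absolute irreducibility is invariant under a change of frame. [folklore] -/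
theorem isAbsolutelyIrreducible_conj [IsTopologicalRing A] (hn : 0 < n) (P : GL (Fin n) A)
    {ρ : FramedRep G A n} (h : ρ.IsAbsolutelyIrreducible) :
    FramedRep.IsAbsolutelyIrreducible (FramedRep.conj P ρ) := by
  have h1 := (span_eq_top_iff_forall_isIrreducible hn (ρ : G →* GL (Fin n) A)).2 h
  refine (span_eq_top_iff_forall_isIrreducible hn
    ((FramedRep.conj P ρ : FramedRep G A n) : G →* GL (Fin n) A)).1 ?_
  have hfun : (fun g => (((FramedRep.conj P ρ : FramedRep G A n) : G →* GL (Fin n) A) g :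
      Matrix (Fin n) (Fin n) A)) = fun g =>
      ((P⁻¹⁻¹ : GL (Fin n) A) : Matrix (Fin n) (Fin n) A) *
        ((ρ g : GL (Fin n) A) : Matrix (Fin n) (Fin n) A) * ((P⁻¹ : GL (Fin n) A) : Matrix _ _ A) := by
    funext g
    rw [inv_inv]
    rfl
  rw [hfun, span_range_units_conj_eq_top_iff]
  exact h1

end Image

/-- **R0 (PROVED, gen 4).** `Γ_{ℚ(√-3)} ⊆ Γ_{ℚ(ζ₃)}` inside `Γ_ℚ`. [folklore] -/
theorem range_absGaloisRestrict_sqrt_subset_cyclotomic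
    (L₁ : Type*) [Field L₁] [Algebra ℚ L₁] [IsSplittingField ℚ L₁ (X ^ 2 - C (-3 : ℚ))]
    (L₂ : Type*) [Field L₂] [Algebra ℚ L₂] [IsCyclotomicExtension {3} ℚ L₂] :
    Set.range (absGaloisRestrict ℚ L₁) ⊆ Set.range (absGaloisRestrict ℚ L₂) := by
  intro γ hγ
  haveI : Fact (Nat.Prime 3) := ⟨Nat.prime_three⟩
  haveI : NeZero ((3 : ℕ) : ℚ) := ⟨by norm_num⟩
  obtain ⟨τ, hτ⟩ := MonoidHom.mem_range.1 ((mem_range_absGaloisRestrict_cyclotomic_iff 3 L₂ γ).2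
    (Summit.ABC.ABC.Theorems.modPCyclotomicCharacter_three_eq_one_of_mem_range L₁ hγ))
  exact ⟨τ, hτ⟩

/-- `restrictField` commutes with a change of frame (definitional). [folklore] -/
theorem restrictField_conj {K : Type*} [Field K] {A : Type*} [Field A] [TopologicalSpace A]
    [IsTopologicalRing A] {n : ℕ} (L : Type*) [Field L] [Algebra K L] (P : GL (Fin n) A)
    (ρ : FramedGaloisRep K A n) :
    FramedGaloisRep.restrictField L (FramedRep.conj P ρ) =
      FramedRep.conj P (FramedGaloisRep.restrictField L ρ) := rfl

/-- **D1 core (PROVED, gen 4)** over variable models. [folklore] -/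
theorem isAbsolutelyIrreducible_restrictField_cyclotomic_of_sqrt
    {L₁ : Type*} [Field L₁] [Algebra ℚ L₁] [IsSplittingField ℚ L₁ (X ^ 2 - C (-3 : ℚ))]
    (L₂ : Type*) [Field L₂] [Algebra ℚ L₂] [IsCyclotomicExtension {3} ℚ L₂]
    (ρ : ModPGaloisRep ℚ (ZMod 3) 2) (P : GL (Fin 2) (ZMod 3))
    (h : FramedRep.IsAbsolutelyIrreducible (FramedGaloisRep.restrictField L₁ ρ)) :
    FramedRep.IsAbsolutelyIrreducible (FramedGaloisRep.restrictField L₂ (FramedRep.conj P ρ)) := by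
  have h₂ : FramedRep.IsAbsolutelyIrreducible
      (FramedGaloisRep.restrictField L₁ (FramedRep.conj P ρ)) := by
    rw [restrictField_conj]
    exact isAbsolutelyIrreducible_conj two_pos P h
  exact isAbsolutelyIrreducible_comp_of_range_subset two_pos (FramedRep.conj P ρ)
    (absGaloisRestrict ℚ L₁) (absGaloisRestrict ℚ L₂)
    (range_absGaloisRestrict_sqrt_subset_cyclotomic L₁ L₂) h₂

/-- **D1 (PROVED, gen 4).** The stub's binder `IsAbsIrreducibleOverSqrt (-3)` gives FLS's
`ModPImageAbsIrreducibleOverCyclotomic W 3`. [folklore] -/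
theorem modPImageAbsIrreducibleOverCyclotomic_three_of_isAbsIrreducibleOverSqrt
    (W : WeierstrassCurve ℚ) [W.IsElliptic] (ρ : ModPGaloisRep ℚ (ZMod 3) 2)
    (hρ : W.IsTorsionGaloisRep 3 ρ) (hirr : ρ.IsAbsIrreducibleOverSqrt (-3)) :
    ModPImageAbsIrreducibleOverCyclotomic W 3 := by
  intro ρ' hρ' L _ _ _
  obtain ⟨P, rfl⟩ := hρ.exists_conj_eq hρ'
  exact @isAbsolutelyIrreducible_restrictField_cyclotomic_of_sqrt
    (X ^ 2 - C (-3 : ℚ) : ℚ[X]).SplittingField _ (_) (IsSplittingField.splittingField _) L _ _ _ ρ P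
    (@hirr (X ^ 2 - C (-3 : ℚ) : ℚ[X]).SplittingField _ (_) (IsSplittingField.splittingField _))

open WeierstrassCurve in
/-- **B4 (PROVED, gen 4).** Integral model. [folklore] -/
theorem exists_integralModel (W : WeierstrassCurve ℚ) [W.IsElliptic] :
    ∃ (E : WeierstrassCurve (𝓞 ℚ)) (C : WeierstrassCurve.VariableChange ℚ)
      (_ : (E.baseChange ℚ).IsElliptic), E.Δ ≠ 0 ∧ C • W = E.baseChange ℚ := by
  obtain ⟨C, hC⟩ := hasGlobalMinimalModel_rat_holds W
  haveI := hC
  refine ⟨(C • W).integralModel (𝓞 ℚ), C, ?_, IsGloballyMinimal.Δ_ne_zero (C • W), ?_⟩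
  · rw [baseChange_integralModel_eq (𝓞 ℚ) (C • W)]; infer_instance
  · rw [baseChange_integralModel_eq (𝓞 ℚ) (C • W)]

/-- `BCDT.IsModular W` read at any level equal to `N_W`. [folklore] -/
theorem isModular_iff_exists_isNewformOf_of_eq (W : WeierstrassCurve ℚ)
    [NeZero (W.conductorNorm ℤ)] {N : ℕ} [NeZero N] (h : W.conductorNorm ℤ = N) :
    BCDT.IsModular W ↔ ∃ f : CuspForm (CongruenceSubgroup.Gamma0 N) 2, IsNewformOf W f := by
  subst h
  rfl

/-- **B6 core (PROVED, gen 4).** Modularity is model-independent. [folklore] -/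
theorem isModular_smul_iff (W : WeierstrassCurve ℚ) [W.IsElliptic]
    (C : WeierstrassCurve.VariableChange ℚ) [NeZero (W.conductorNorm ℤ)]
    [NeZero ((C • W).conductorNorm ℤ)] : BCDT.IsModular (C • W) ↔ BCDT.IsModular W := by
  rw [isModular_iff_exists_isNewformOf_of_eq (C • W) (W.conductorNorm_smul_rat C)]
  refine exists_congr fun f ↦ ?_
  simp only [IsNewformOf, WeierstrassCurve.LFunction_smul]

/-- **B6 (PROVED, gen 4).** [folklore] -/
theorem isModular_of_smul_eq (W : WeierstrassCurve ℚ) [W.IsElliptic] [NeZero (W.conductorNorm ℤ)]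
    (C : WeierstrassCurve.VariableChange ℚ) (W' : WeierstrassCurve ℚ) [NeZero (W'.conductorNorm ℤ)]
    (hCW : C • W = W') : BCDT.IsModular W' → BCDT.IsModular W := by
  subst hCW
  exact (isModular_smul_iff W C).mp

/-! ## §2  The fact-web edge W1: `FLS2015_theorem3 → B3 → IsModularOfAbsIrrThree → CDT_theorem_7_2_1` -/

/-- **B3 (L; verbatim gen 3/4 and sibling k2): adelic ⇒ classical over `ℚ`.** Split in §3. -/
def IsModularOfAutomorphicRat : Prop :=
  ∀ (E : WeierstrassCurve (𝓞 ℚ)) [(E.baseChange ℚ).IsElliptic]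
    [NeZero ((E.baseChange ℚ).conductorNorm ℤ)],
    E.Δ ≠ 0 → IsAutomorphicOfWeightZero E → BCDT.IsModular (E.baseChange ℚ)

/-- What the FLS road REALLY outputs at `ℓ = 3` (no condition at `3`, no residual modularity):
every elliptic `W/ℚ` with `W[3]|_{ℚ(√-3)}` absolutely irreducible is modular.  Strictly between
`CDT_theorem_7_2_1` (which adds `27 ∤ N`) and BCDT Thm A. [cite: FreitasLeHungSiksek2015, Thm. 3] -/
def IsModularOfAbsIrrThree : Prop :=
  ∀ (W : WeierstrassCurve ℚ) [W.IsElliptic] [NeZero (W.conductorNorm ℤ)]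
    (ρ : ModPGaloisRep ℚ (ZMod 3) 2),
    W.IsTorsionGaloisRep 3 ρ → ρ.IsAbsIrreducibleOverSqrt (-3) → BCDT.IsModular W

/-- **W1a (PROVED) = gen 4's closer D minus its last token.** [cite: FreitasLeHungSiksek2015, Thm. 3] -/
theorem isModularOfAbsIrrThree_of_FLS2015_theorem3 (h : FLS2015_theorem3)
    (hB3 : IsModularOfAutomorphicRat) : IsModularOfAbsIrrThree := by
  intro W _ _ ρ hρ hirr
  obtain ⟨E, C, _, hΔ, hCW⟩ := exists_integralModel W
  haveI : NeZero ((E.baseChange ℚ).conductorNorm ℤ) :=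
    ⟨(WeierstrassCurve.conductorNorm_pos_holds (E.baseChange ℚ)).ne'⟩
  have himgW : ModPImageAbsIrreducibleOverCyclotomic W 3 :=
    modPImageAbsIrreducibleOverCyclotomic_three_of_isAbsIrreducibleOverSqrt W ρ hρ hirr
  have himgE : ModPImageAbsIrreducibleOverCyclotomic (E.baseChange ℚ) 3 := by
    intro ρ' hρ' L _ _ _
    have hW : W.IsTorsionGaloisRep 3 ρ' := by
      have h' := MatarNekovar2019.isTorsionGaloisRep_smul (E.baseChange ℚ) C⁻¹ hρ'
      rwa [← hCW, inv_smul_smul] at h'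
    exact himgW ρ' hW L
  have hE : IsAutomorphicOfWeightZero E := h ℚ E hΔ 3 (Or.inl rfl) himgE
  exact isModular_of_smul_eq W C (E.baseChange ℚ) hCW (hB3 E hΔ hE)

/-- **W1b (PROVED).** The edge into the SEAT (`27 ∤ N_E` unused). Landable as a Literature
`…Proofs` edge so that any FLS-side discharge propagates to every consumer of `CDT_theorem_7_2_1`.
[cite: ConradDiamondTaylor1999, Thm. 7.2.1] -/
theorem CDT_theorem_7_2_1_of_isModularOfAbsIrrThree (h : IsModularOfAbsIrrThree) :
    CDT_theorem_7_2_1 :=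
  fun W _ _ ρ hρ hirr _ ↦ h W ρ hρ hirr

/-- **W1 (PROVED): `FLS2015_theorem3 → B3 → CDT_theorem_7_2_1`.** [cite: FreitasLeHungSiksek2015, Thm. 3] -/
theorem CDT_theorem_7_2_1_of_FLS2015_theorem3 (h : FLS2015_theorem3) (hB3 : IsModularOfAutomorphicRat) :
    CDT_theorem_7_2_1 :=
  CDT_theorem_7_2_1_of_isModularOfAbsIrrThree (isModularOfAbsIrrThree_of_FLS2015_theorem3 h hB3)

/-- And hence the stub (PROVED modulo the named fact + B3). -/
theorem stub_liftThree_of_FLS2015_theorem3 (h : FLS2015_theorem3) (hB3 : IsModularOfAutomorphicRat) :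
    SigStubLiftThree :=
  stub_liftThree_of_CDT_theorem_7_2_1 (CDT_theorem_7_2_1_of_FLS2015_theorem3 h hB3)

/-! ## §3  FAMILY-1 TRANSFER weight `1 ↦ 2`: the split of B3 / D4a into cycle-sized ports

Dictionary (tree, weight one ↦ here, weight two): `IsOfWeightOne` (parameter `{0,0}`, sign `-1`)
↦ `HasWeightZero` (parameter `{ρ₀, ρ₁} = {1/2, -1/2}`) + trivial central character (sign `+1`);
Casimir `-1/2` ↦ `0`; `X̄X = -(m-1)²` on weight `m` ↦ `X̄X = -m(m-2)` (`raiseFun_lowerFun_of_isWeightVec`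
with `c = 0`); extraction of a weight-`1` vector killed by `X` from an ODD `K`-type ↦ of a weight-`2`
vector killed by `X` from an EVEN `K`-type, the weight-`0` rung being excluded by a Liouville input
(weight-`0` holomorphic bounded `Γ₁(N)`-invariant ⇒ constant, `ModularForm.eq_const_of_weight_zero`;
cuspidal ⇒ `0`); descent `adelicDescentCuspForm N 1` ↦ `adelicDescentCuspForm N 2` (general `k`,
PROVED); `T_{v,1} φ_f = √p φ_{T_p f}` ↦ `T_{v,1} φ_f = φ_{T_p f}`
(`heckeOperator_principalCongruenceLevel_adelicLiftFunA_one`, general `k`, PROVED);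
`(X-α)(X-β) = X² - a_p X + ε(p)` ↦ `(X-√p α)(X-√p β) = X² - a_p X + p ε(p)`. -/

section WeightTwo

variable {hcpt : isCompact_glFiniteIntegralLevel 2 ℚ}
  {π : AutomorphicRepData (AutomorphyDatum.gl 2 ℚ hcpt)}

/-- **H-arch (PROVED here).** Weight zero for `GL₂/ℚ` is the Harish-Chandra parameter `{1/2, -1/2}`
(unfold `weightZeroInfinityType 2 ℚ`, `rhoGL 2 = (1/2, -1/2)`); then the tree's
`lieDeriv_one_sub_smul_mem` / `sum_lieDeriv_single_sub_smul_mem` give `Z = 0` and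
`∑ E_{ab}E_{ba} = 0`, i.e. `Ω = 0` on `W` (`GL2Real.casimirFun_add_half_zz`).
[cite: Clozel1990, §3.5] -/
theorem hasArchParameter_of_hasWeightZero (h : π.HasWeightZero) :
    π.HasArchParameter fun _ ↦ ({(1 / 2 : ℂ), -(1 / 2 : ℂ)} : Multiset ℂ) := by
  obtain ⟨_, h2⟩ := h
  have key : (fun σ : ℚ →+* ℂ ↦ (weightZeroInfinityType 2 ℚ σ).map ArchWeight.a) =
      fun _ ↦ ({(1 / 2 : ℂ), -(1 / 2 : ℂ)} : Multiset ℂ) := by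
    funext σ
    rw [weightZeroInfinityType_apply, Multiset.map_map, Fin.univ_val_map]
    have h0 : (ArchWeight.a ∘ weightZeroArchWeight 2) 0 = 1 / 2 := by
      simp [weightZeroArchWeight_a, rhoGL]; norm_num
    have h1 : (ArchWeight.a ∘ weightZeroArchWeight 2) 1 = -(1 / 2) := by
      simp [weightZeroArchWeight_a, rhoGL]; norm_num
    rw [List.ofFn_succ, List.ofFn_succ, List.ofFn_zero]
    simp only [Fin.succ_zero_eq_one, h0, h1]
    rfl
  rw [key] at h2
  exact h2

/-- **H-extract (M; pure `(𝔤, K)`-algebra, port of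
`GL2Real.exists_isWeightVec_one_lowerFun_eq_zero_of_finite` with Casimir `0` and EVEN parity).**
On a space `W₁` of arch-smooth functions stable under `ε`, the Lie derivatives and rotations, with
`Ω = 0`, `r(π) = -1_∞` acting trivially (even `K`-types) and NO non-zero weight-`0` vector killed
by `X` (Liouville input), a non-zero `K`-finite vector yields `ψ ≠ 0` of weight `2` with `X ψ = 0`:
from weight `2j ≥ 4` descend by `X` (`X̄X = -m(m-2) ≠ 0`), at weight `2` either `Xu = 0` or
`w = Xu ≠ 0` has weight `0` and `X̄ w = 0`, so `r(ε) w` is weight `0` killed by `X` — excluded; from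
weight `0`, `Xv ≠ 0` (else excluded) and `r(ε)(Xv)` is weight `2` killed by `X`; negative weights by `ε`.
[cite: Bump1997, Exercise 2.1.7 and Thm. 2.5.4] [cite: Gelbart1997, Remark 2.5.5] -/
theorem exists_isWeightVec_two_lowerFun_eq_zero_of_finite {G : Type*} [Group G]
    {ι : (RealMatrixGroup.gl ℝ (Fin 2)).carrier →* G} {W₁ : Submodule ℂ (G → ℂ)}
    (hsmooth : ∀ φ ∈ W₁, IsArchSmooth ι φ)
    (heps : ∀ φ ∈ W₁, archTranslate ι epsK φ ∈ W₁)
    (hlie : ∀ (X : Matrix (Fin 2) (Fin 2) ℝ), ∀ φ ∈ W₁, lieDeriv ι (toLie X) φ ∈ W₁)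
    (hcas : ∀ φ ∈ W₁, casimirFun ι φ = 0)
    (heven : ∀ φ ∈ W₁, ∀ g, φ (g * ι (rotK Real.pi)) = φ g)
    (hliouville : ∀ ψ ∈ W₁, IsWeightVec ι 0 ψ → lowerFun ι ψ = 0 → ψ = 0)
    {φ : G → ℂ} (hφ0 : φ ≠ 0)
    (hfin : ∃ V : Submodule ℂ (G → ℂ), FiniteDimensional ℂ V ∧ φ ∈ V ∧ V ≤ W₁ ∧
      ∀ θ : ℝ, ∀ ψ ∈ V, archTranslate ι (rotK θ) ψ ∈ V) :
    ∃ ψ ∈ W₁, ψ ≠ 0 ∧ IsWeightVec ι 2 ψ ∧ lowerFun ι ψ = 0 := by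
  sorry

/-- **H-liouville (S/M).** The Liouville input on `W₁ = W ∩ Fix(K₁(N))` for CUSPIDAL `W`: a
`K₁(N)`-fixed cuspidal form of `SO(2)`-weight `0` killed by `X` descends (`adelicDescent N 0`,
`mdifferentiable_archDescent_of_lowering`) to a bounded holomorphic `Γ₁(N)`-invariant function on
`ℍ`, a weight-`0` modular form, hence a constant (`ModularForm.eq_const_of_weight_zero`), hence `0`
by cuspidality (constant term). [cite: DiamondShurman2005, §4.3 (p. 119)] [cite: Gelbart1975, Prop. 3.1] -/
theorem eq_zero_of_isWeightVec_zero_of_lowerFun_eq_zero (hcusp : π.W ≤ cuspFormsGL 2 ℚ hcpt)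
    {N : ℕ} [NeZero N] {ψ : (AdelicGroupData.gl 2 ℚ).Adelic → ℂ} (hψ : ψ ∈ π.W)
    (hfix : ∀ u ∈ gammaOneFiniteLevel ℚ (Ideal.span {(N : 𝓞 ℚ)}),
      rightTranslation (AdelicGroupData.gl 2 ℚ) (GLn.ofFinite 2 ℚ u) ψ = ψ)
    (h0 : IsWeightVec Rat.iotaA 0 ψ) (hX : lowerFun Rat.iotaA ψ = 0) : ψ = 0 := by
  sorry

/-- **H-even (S/M; the Dirichlet-primes argument of the tree's
`exists_mem_nebentypusSubspace_of_adelicLiftFunA_mem`, run for the trivial character).** If the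
central elements `ϖ_v · 1` act trivially on the `K₁(N)`-fixed form `φ` for all but finitely many `v`
(for `π_E`: `T_{v,2} = e₂(α) = αβ = q_v / q_v = 1` from the Hecke polynomial `X² - a_v X + q_v`,
`exists_hasSatakeParamAt_of_hasHeckePolynomialAt_frobPoly` + `hasSatakeParamAt_unique_holds`) and
`A_G` acts trivially, then `-1_∞` acts trivially on `φ`: pick a prime `ℓ ≡ -1 (mod N)` off the
finite set (`Nat.forall_exists_prime_gt_and_eq_mod`); `(ℓ)_ℓ = ℓ_ℚ · (ℓ⁻¹)_∞ · ∏_{p ≠ ℓ} (ℓ⁻¹)_p`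
with `(ℓ⁻¹)_p ∈ (-1)(1 + N ℤ_p) ⊂ (-1) K₁(N)_p` for `p ∣ N`. [cite: DiamondShurman2005, §5.2 p. 169] -/
theorem apply_mul_iotaA_rotK_pi
    (hAG : ∀ φ ∈ π.W, ∀ z ∈ (AdelicGroupData.gl 2 ℚ).center', ∀ g, φ (z * g) = φ g)
    {N : ℕ} [NeZero N] {φ : (AdelicGroupData.gl 2 ℚ).Adelic → ℂ} (hφ : φ ∈ π.W)
    (hfix : ∀ u ∈ gammaOneFiniteLevel ℚ (Ideal.span {(N : 𝓞 ℚ)}),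
      rightTranslation (AdelicGroupData.gl 2 ℚ) (GLn.ofFinite 2 ℚ u) φ = φ)
    (hctr : ∀ᶠ v : HeightOneSpectrum (𝓞 ℚ) in Filter.cofinite,
      rightTranslation (AdelicGroupData.gl 2 ℚ) (heckeDiagAt 2 ℚ v (Rat.localUniformizer v) 2) φ = φ) :
    ∀ g, φ (g * Rat.iotaA (rotK Real.pi)) = φ g := by
  sorry

/-- **H-hecke (M; port `1 ↦ 2` of `hasSatakeParamAt_of_adelicLiftFunA_mem`, mechanical off the
PROVED weight-general `heckeOperator_principalCongruenceLevel_adelicLiftFunA_one/two`: at `k = 2`,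
`T_{v,1} φ_f = φ_{T_p f}`, `T_{v,2} φ_f = φ_{⟨p⟩ f}`).** If `T_p f = a f`, `⟨p⟩ f = e f` for
`f ∈ S₂(Γ₁(N))`, `f ≠ 0`, `φ_f ∈ W = π` (`W' = ⊥`), then `π` has at `v ∣ p ∤ N` a Satake parameter
`{α, β}` with `(X - √p α)(X - √p β) = X² - a X + p e` (Gelbart (2.5.1) with `k = 2`).
[cite: Gelbart1997, Prop. 2.5 (b), (2.5.1)] [cite: Gelbart1975, Lemma 3.7] -/
theorem hasSatakeParamAt_of_adelicLiftFunA_mem_two (hbot : π.W' = ⊥) {N : ℕ} [NeZero N]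
    {f : CuspForm (Gamma1 N) 2} (hf0 : f ≠ 0) (hfW : adelicLiftFunA N 2 f ∈ π.W)
    {v : HeightOneSpectrum (𝓞 ℚ)} (hv : ¬ v.asIdeal ∣ Ideal.span {(N : 𝓞 ℚ)}) {a e : ℂ}
    (hT : Literature.NumberTheory.EllipticCurves.ModularForms.heckeT (Gamma1 N) 2 (natGenerator v) f = a • f)
    (hD : diamondOp N 2 ((natGenerator v : ℕ) : ZMod N) f = e • f) :
    ∃ α : Multiset ℂ, π.HasSatakeParamAt v α ∧
      satakePolynomial (α.map fun z ↦ ((Real.sqrt (natGenerator v : ℝ) : ℝ) : ℂ) * z) =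
        X ^ 2 - C a * X + C ((natGenerator v : ℂ) * e) := by
  sorry

/-- **H-dict (M; the assembly = port `1 ↦ 2` of `IsOfWeightOne.exists_isNewform1_of_exists_fixed`
+ `exists_cuspForm_of_fixed`, ~80 lines of bookkeeping once H-arch … H-hecke are in).** A CUSPIDAL
weight-zero `π` of `GL₂(𝔸_ℚ)` whose unramified central values are trivial off a finite set comes
from a newform `f ∈ S₂(Γ₁(N₀))` with trivial nebentypus whose Hecke polynomials are the Hecke
polynomials of `π` at every `p ∤ N₀`: clean model (`exists_isShiftRealisation_of_sSup_irreducible`,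
`IsShiftRealisation.hasArchParameter`, `μ = 0` from `Z = s₁ + s₂ = 0`), new vector
(`CuspidalAutomorphicRepData.exists_gammaOneFiniteLevel_fixed`, PROVED), least level (`Nat.find`),
H-even ⇒ H-extract (with H-liouville) ⇒ weight-`2` vector killed by `X` ⇒ `adelicDescentCuspForm N₀ 2`,
new by minimality (`mem_newSubspace1_of_forall_fixed`), Atkin–Lehner–Li
(`exists_isNewform1_of_mem_newSubspace1`, `atkinLehnerMainLemma1_holds N₀ 2`), H-hecke.
[cite: Gelbart1975, Thm. 5.19] [cite: Gelbart1997, Prop. 2.5 (converse) and Corollary]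
[cite: Casselman1973, Thm. 1] -/
theorem exists_isNewform1_two_of_hasWeightZero (ϖ : CuspidalAutomorphicRepData 2 ℚ hcpt)
    (h0 : ϖ.1.HasWeightZero)
    (hctr : ∀ᶠ v : HeightOneSpectrum (𝓞 ℚ) in Filter.cofinite,
      ∃ α : Multiset ℂ, ϖ.1.HasSatakeParamAt v α ∧ α.prod = 1) :
    ∃ (N₀ : ℕ) (_ : NeZero N₀) (f : CuspForm (Gamma1 N₀) 2), IsNewform1 f ∧
      (∀ d : (ZMod N₀)ˣ, diamondOp N₀ 2 (d : ZMod N₀) f = f) ∧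
      ∀ v : HeightOneSpectrum (𝓞 ℚ), ¬ natGenerator v ∣ N₀ →
        ϖ.1.HasHeckePolynomialAt v
          ((Literature.NumberTheory.EllipticCurves.ModularForms.heckePolynomial f (primesEquiv v : Nat.Primes)).map
            (algebraMap (coeffCharField f) ℂ)) := by
  sorry

end WeightTwo

/-- **D4a (L as one block; M+M+S+S+S as split above) — verbatim the sibling k2's statement
(`STUB_IDEAS_stub_liftFive_2g3.lean:323`), the ONE residual debt of B3.**  From H-dict: descend the
trivial-nebentypus newform to `Γ₀(N₀)` (`exists_liftToGamma1_eq_of_forall_diamondOp_eq`,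
`isNewform1_liftToGamma1_iff_holds`, both PROVED), and compare Hecke polynomials with
`X² - a_q(E) X + q` at `q ∤ N₀ Δ(E)` by uniqueness of Satake parameters
(`hasSatakeParamAt_unique_holds`) to read off `a_q(g) = a_q(E ⊗ ℚ)` (`R = Δ(E).natAbs`).
[cite: Gelbart1975, Thm. 5.19] [cite: ACCGHLNSTT2023, §7.1] -/
theorem exists_isNewform0_of_isAutomorphicOfWeightZero_rat (E : WeierstrassCurve (𝓞 ℚ))
    (hΔ : E.Δ ≠ 0) (hE : IsAutomorphicOfWeightZero E) :
    ∃ (M : ℕ) (_ : NeZero M) (g : CuspForm (CongruenceSubgroup.Gamma0 M) 2), IsNewform0 g ∧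
      ∃ (R : ℕ) (_ : NeZero R), ∀ q : ℕ, q.Prime → ¬ q ∣ M * R →
        cuspCoeff g q = ((E.baseChange ℚ).LFunction q : ℂ) := by
  sorry

/-- **B3 from D4a (PROVED modulo D4a; pattern of k2's `isModularGaloisRepTate_of_isAutomorphicOfWeightZero`):**
D4a + Serre 1987 §4.6 in the tree's form `isModular_of_isNewform0_of_cuspCoeff_eq_off_of_three_facts`
(Faltings discharged by `isIsogenous_iff_frobeniusTrace_eq_holds`; Eichler–Shimura `hES` and
Carayol `hC` granted — both already in the line's trust base). [cite: Serre1987, §4.6] -/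
theorem isModularOfAutomorphicRat_of_D4a (hES : eichlerShimuraConstruction)
    (hC : ∀ (N : ℕ) [NeZero N], IsNewformOf.level_eq_conductorNorm (N := N))
    (hD4a : ∀ (E : WeierstrassCurve (𝓞 ℚ)), E.Δ ≠ 0 → IsAutomorphicOfWeightZero E →
      ∃ (M : ℕ) (_ : NeZero M) (g : CuspForm (CongruenceSubgroup.Gamma0 M) 2), IsNewform0 g ∧
        ∃ (R : ℕ) (_ : NeZero R), ∀ q : ℕ, q.Prime → ¬ q ∣ M * R →
          cuspCoeff g q = ((E.baseChange ℚ).LFunction q : ℂ)) :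
    IsModularOfAutomorphicRat := by
  intro E _ _ hΔ hE
  obtain ⟨M, _, g, hg, R, _, h⟩ := hD4a E hΔ hE
  exact isModular_of_isNewform0_of_cuspCoeff_eq_off_of_three_facts hES
    WeierstrassCurve.isIsogenous_iff_frobeniusTrace_eq_holds hC (E.baseChange ℚ) hg h

end Summit.ABC.ABC.Cruxes.FreyModularity.Sketch.StubIdeas1g5

end
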